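import Summits.ResolutionOfSingularities.ResolutionOfSingularities.Theorems.FrobeniusLadderFRationalResolutionWeaklyFRegularSurfaceLocal
import Summits.ResolutionOfSingularities.ResolutionOfSingularities.Theorems.FrobeniusLadderFRationalResolutionGorensteinGermIdentityModel
import Summits.ResolutionOfSingularities.ResolutionOfSingularities.Theorems.FrobeniusLadderFRationalResolutionModelIntegral
import Summits.ResolutionOfSingularities.ResolutionOfSingularities.Theorems.FrobeniusLadderFRationalResolutionModelDimension
import Summits.ResolutionOfSingularities.ResolutionOfSingularities.Theorems.FrobeniusLadderFRationalResolutionFRationalSurfaceLocal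
import Literature.AlgebraicGeometry.Resolution.QuasiProjectiveResolution
import Literature.AlgebraicGeometry.Resolution.CanonicalResolutionProofs
import HarnessLib

/-!
# The crux in dimension 2, reduced to non-Gorenstein F-rational surface germs and rung 4′

Support file for crux stmt-ResolutionOfSingularities-15317 (`FrobeniusLadder.FRationalResolution`),
line `Sketch`, continuation seat c3, cycle 7 (theme D2R). The crux is EQUIVALENT to the conjunction
of rung 3½ (`WeaklyFRegularModification`: every integral F-rational `X/k` has a proper birational
model with weakly-F-regular stalks) and rung 4′ (resolution of weakly-F-regular varieties)
(`fRationalResolution_iff_rungs`). IN DIMENSION 2 this file sharpens the 3½ half to a ONE-GERM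
problem at the NON-GORENSTEIN points only:

`fRationalResolution_surfaces_of_germs`: assume (`hgerm`) every integral F-rational surface germ
at a singular point whose parameter ideals do NOT all have cyclic socle admits, on some open
neighbourhood containing no other singular point, a proper weakly-F-regular local model which is an
isomorphism over the regular locus (with dense preimage); and assume rung 4′ (`h₂`, verbatim).
Then every integral separated finite-type F-rational SURFACE over a field of characteristic `p`
has a resolution of singularities. Ingredients: at the Gorenstein singular points the identity of a
small neighbourhood is already a weakly-F-regular local model (`identity_local_model_of_socle_cyclic`,
rung 3½ on the Gorenstein sector p139765); the local models glue
(`weaklyFRegularModification_surface_of_local`, p155492, over the punctual engine p154674); rung 4′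
resolves the glued model; `Scheme.HasResolution.of_isBirational` descends.

`fRationalResolution_surfaces_of_two_germ_problems`: the same with rung 4′ replaced by ITS germ
form in dimension 2 — local resolutions at the (finitely many) singular points of weakly-F-regular
surfaces — using that the glued weakly-F-regular model is again an integral F-rational surface
(`isIntegral_of_model`, `topologicalKrullDim_eq_of_model`) and THE CRUX IN DIMENSION 2 IS LOCAL
(`hasResolution_fRational_surface_of_local`, p149439). So, for surfaces, the crux follows from two
ONE-GERM statements: (1) non-Gorenstein F-rational surface germs have weakly-F-regular local proper
models; (2) weakly-F-regular surface germs have local resolutions. [folklore assembly;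
cite: HochsterHuneke1994 (Gorenstein F-rational ⇒ F-regular); Lipman1969 (context)]
-/

-- single-problem summit: the doubled namespace component is forced
set_option linter.dupNamespace false

noncomputable section

namespace Summit.ResolutionOfSingularities.ResolutionOfSingularities.Theorems.FRationalResolution

open CategoryTheory AlgebraicGeometry TopologicalSpace
open Literature.AlgebraicGeometry.Resolution

/-- **THE CRUX IN DIMENSION 2, REDUCED TO GERMS.** If (i) every NON-GORENSTEIN singular point of
an integral F-rational surface over a field of characteristic `p` has an open neighbourhood (with
no other singular point) carrying a proper weakly-F-regular local model that is an isomorphism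
over the regular locus with dense preimage, and (ii) rung 4′ holds (every separated finite-type
`X/k` whose stalks are domains with every ideal tightly closed has a resolution), then every
integral separated finite-type F-rational surface `X/k` has a resolution of singularities.
[folklore assembly] -/
theorem fRationalResolution_surfaces_of_germs
    (hgerm : ∀ (p : ℕ), p.Prime → ∀ (k : Type) [Field k] [CharP k p] (X : Scheme.{0})
      (f : X ⟶ Spec (.of k)) [IsSeparated f] [LocallyOfFiniteType f] [QuasiCompact f]
      [IsIntegral X],
      (∀ x : X, IsDomain (X.presheaf.stalk x) ∧ ∀ d : ℕ, ringKrullDim (X.presheaf.stalk x) = d →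
        ∀ s : Fin d → X.presheaf.stalk x, (Ideal.span (Set.range s)).radical.IsMaximal →
        ∀ y c : X.presheaf.stalk x, c ≠ 0 →
        (∀ e : ℕ, c * y ^ p ^ e ∈ Ideal.span ((fun z : X.presheaf.stalk x => z ^ p ^ e) ''
          (Ideal.span (Set.range s) : Set (X.presheaf.stalk x)))) → y ∈ Ideal.span (Set.range s)) →
      topologicalKrullDim X ≤ 2 →
      ∀ s : X, s ∉ Scheme.regularLocus X →
      (¬ ∀ d : ℕ, ringKrullDim (X.presheaf.stalk s) = d → ∀ t : Fin d → X.presheaf.stalk s,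
        (Ideal.span (Set.range t)).radical.IsMaximal →
        ∃ u : X.presheaf.stalk s, (Ideal.span (Set.range t)).colon
          (IsLocalRing.maximalIdeal (X.presheaf.stalk s) : Set (X.presheaf.stalk s)) =
          Ideal.span (Set.range t) ⊔ Ideal.span {u}) →
      ∃ (V : X.Opens), s ∈ V ∧ (∀ t : X, t ∉ Scheme.regularLocus X → t ∈ V → t = s) ∧
        ∃ (Y : Scheme.{0}) (ρ : Y ⟶ V), IsProper ρ ∧
          (∀ y : Y, IsDomain (Y.presheaf.stalk y) ∧ ∀ I : Ideal (Y.presheaf.stalk y),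
            ∀ a c : Y.presheaf.stalk y, c ≠ 0 →
            (∀ e : ℕ, c * a ^ p ^ e ∈ Ideal.span ((fun z : Y.presheaf.stalk y => z ^ p ^ e) ''
              (I : Set (Y.presheaf.stalk y)))) → a ∈ I) ∧
          IsIso (ρ ∣_ (V.ι ⁻¹ᵁ ⟨Scheme.regularLocus X,
            isOpen_regularLocus_of_locallyOfFiniteType_field f⟩)) ∧
          Dense ((ρ ⁻¹ᵁ (V.ι ⁻¹ᵁ ⟨Scheme.regularLocus X,
            isOpen_regularLocus_of_locallyOfFiniteType_field f⟩) : Y.Opens) : Set Y))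
    (h₂ : ∀ (p : ℕ), p.Prime → ∀ (k : Type) [Field k] [CharP k p] (X : Scheme.{0})
      (f : X ⟶ Spec (.of k)), IsSeparated f → LocallyOfFiniteType f → QuasiCompact f →
      (∀ x : X, IsDomain (X.presheaf.stalk x) ∧ ∀ I : Ideal (X.presheaf.stalk x),
        ∀ y c : X.presheaf.stalk x, c ≠ 0 →
        (∀ e : ℕ, c * y ^ p ^ e ∈ Ideal.span ((fun z : X.presheaf.stalk x => z ^ p ^ e) ''
          (I : Set (X.presheaf.stalk x)))) → y ∈ I) →
      Scheme.HasResolution X)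
    (p : ℕ) (hp : p.Prime) (k : Type) [Field k] [CharP k p] (X : Scheme.{0})
    (f : X ⟶ Spec (.of k)) [IsSeparated f] [LocallyOfFiniteType f] [QuasiCompact f] [IsIntegral X]
    (hFR : ∀ x : X, IsDomain (X.presheaf.stalk x) ∧ ∀ d : ℕ, ringKrullDim (X.presheaf.stalk x) = d →
      ∀ s : Fin d → X.presheaf.stalk x, (Ideal.span (Set.range s)).radical.IsMaximal →
      ∀ y c : X.presheaf.stalk x, c ≠ 0 →
      (∀ e : ℕ, c * y ^ p ^ e ∈ Ideal.span ((fun z : X.presheaf.stalk x => z ^ p ^ e) ''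
        (Ideal.span (Set.range s) : Set (X.presheaf.stalk x)))) → y ∈ Ideal.span (Set.range s))
    (hdim : topologicalKrullDim X ≤ 2) :
    Scheme.HasResolution X := by
  classical
  -- a local weakly-F-regular model at EVERY singular point: the identity at the Gorenstein ones
  -- (rung 3½ on the Gorenstein sector), the hypothesis `hgerm` at the others
  have hloc : ∀ s : X, s ∉ Scheme.regularLocus X → ∃ (V : X.Opens), s ∈ V ∧
      (∀ t : X, t ∉ Scheme.regularLocus X → t ∈ V → t = s) ∧
      ∃ (Y : Scheme.{0}) (ρ : Y ⟶ V), IsProper ρ ∧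
        (∀ y : Y, IsDomain (Y.presheaf.stalk y) ∧ ∀ I : Ideal (Y.presheaf.stalk y),
          ∀ a c : Y.presheaf.stalk y, c ≠ 0 →
          (∀ e : ℕ, c * a ^ p ^ e ∈ Ideal.span ((fun z : Y.presheaf.stalk y => z ^ p ^ e) ''
            (I : Set (Y.presheaf.stalk y)))) → a ∈ I) ∧
        IsIso (ρ ∣_ (V.ι ⁻¹ᵁ ⟨Scheme.regularLocus X,
          isOpen_regularLocus_of_locallyOfFiniteType_field f⟩)) ∧
        Dense ((ρ ⁻¹ᵁ (V.ι ⁻¹ᵁ ⟨Scheme.regularLocus X,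
          isOpen_regularLocus_of_locallyOfFiniteType_field f⟩) : Y.Opens) : Set Y) := by
    intro s hs
    by_cases hsoc : ∀ d : ℕ, ringKrullDim (X.presheaf.stalk s) = d →
        ∀ t : Fin d → X.presheaf.stalk s, (Ideal.span (Set.range t)).radical.IsMaximal →
        ∃ u : X.presheaf.stalk s, (Ideal.span (Set.range t)).colon
          (IsLocalRing.maximalIdeal (X.presheaf.stalk s) : Set (X.presheaf.stalk s)) =
          Ideal.span (Set.range t) ⊔ Ideal.span {u}
    · exact identity_local_model_of_socle_cyclic p hp k X f hFR hdim s hs hsoc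
    · exact hgerm p hp k X f hFR hdim s hs hsoc
  -- glue (piece X₁ in dimension 2 is punctual), then resolve the weakly-F-regular model by rung 4′
  obtain ⟨X', π, hπ, hbir, hW⟩ :=
    weaklyFRegularModification_surface_of_local p hp k X f hFR hdim hloc
  haveI := hπ
  exact Scheme.HasResolution.of_isBirational π hbir
    (h₂ p hp k X' (π ≫ f) inferInstance inferInstance inferInstance hW)

/-- **THE CRUX FOR SURFACES FROM TWO ONE-GERM PROBLEMS.** Assume (1) (`hgerm₁`) every
non-Gorenstein singular point of an integral F-rational surface has an open neighbourhood (with no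
other singular point) carrying a proper weakly-F-regular local model, iso over the regular locus
with dense preimage; (2) (`hgerm₂`) every singular point of an integral separated finite-type
surface whose stalks are domains with every ideal tightly closed has such a neighbourhood carrying
a proper REGULAR local model (a local resolution). Then every integral separated finite-type
F-rational surface over a field of characteristic `p` has a resolution of singularities.
[folklore assembly] -/
theorem fRationalResolution_surfaces_of_two_germ_problems
    (hgerm₁ : ∀ (p : ℕ), p.Prime → ∀ (k : Type) [Field k] [CharP k p] (X : Scheme.{0})
      (f : X ⟶ Spec (.of k)) [IsSeparated f] [LocallyOfFiniteType f] [QuasiCompact f]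
      [IsIntegral X],
      (∀ x : X, IsDomain (X.presheaf.stalk x) ∧ ∀ d : ℕ, ringKrullDim (X.presheaf.stalk x) = d →
        ∀ s : Fin d → X.presheaf.stalk x, (Ideal.span (Set.range s)).radical.IsMaximal →
        ∀ y c : X.presheaf.stalk x, c ≠ 0 →
        (∀ e : ℕ, c * y ^ p ^ e ∈ Ideal.span ((fun z : X.presheaf.stalk x => z ^ p ^ e) ''
          (Ideal.span (Set.range s) : Set (X.presheaf.stalk x)))) → y ∈ Ideal.span (Set.range s)) →
      topologicalKrullDim X ≤ 2 →
      ∀ s : X, s ∉ Scheme.regularLocus X →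
      (¬ ∀ d : ℕ, ringKrullDim (X.presheaf.stalk s) = d → ∀ t : Fin d → X.presheaf.stalk s,
        (Ideal.span (Set.range t)).radical.IsMaximal →
        ∃ u : X.presheaf.stalk s, (Ideal.span (Set.range t)).colon
          (IsLocalRing.maximalIdeal (X.presheaf.stalk s) : Set (X.presheaf.stalk s)) =
          Ideal.span (Set.range t) ⊔ Ideal.span {u}) →
      ∃ (V : X.Opens), s ∈ V ∧ (∀ t : X, t ∉ Scheme.regularLocus X → t ∈ V → t = s) ∧
        ∃ (Y : Scheme.{0}) (ρ : Y ⟶ V), IsProper ρ ∧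
          (∀ y : Y, IsDomain (Y.presheaf.stalk y) ∧ ∀ I : Ideal (Y.presheaf.stalk y),
            ∀ a c : Y.presheaf.stalk y, c ≠ 0 →
            (∀ e : ℕ, c * a ^ p ^ e ∈ Ideal.span ((fun z : Y.presheaf.stalk y => z ^ p ^ e) ''
              (I : Set (Y.presheaf.stalk y)))) → a ∈ I) ∧
          IsIso (ρ ∣_ (V.ι ⁻¹ᵁ ⟨Scheme.regularLocus X,
            isOpen_regularLocus_of_locallyOfFiniteType_field f⟩)) ∧
          Dense ((ρ ⁻¹ᵁ (V.ι ⁻¹ᵁ ⟨Scheme.regularLocus X,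
            isOpen_regularLocus_of_locallyOfFiniteType_field f⟩) : Y.Opens) : Set Y))
    (hgerm₂ : ∀ (p : ℕ), p.Prime → ∀ (k : Type) [Field k] [CharP k p] (X : Scheme.{0})
      (f : X ⟶ Spec (.of k)) [IsSeparated f] [LocallyOfFiniteType f] [QuasiCompact f]
      [IsIntegral X],
      (∀ x : X, IsDomain (X.presheaf.stalk x) ∧ ∀ I : Ideal (X.presheaf.stalk x),
        ∀ y c : X.presheaf.stalk x, c ≠ 0 →
        (∀ e : ℕ, c * y ^ p ^ e ∈ Ideal.span ((fun z : X.presheaf.stalk x => z ^ p ^ e) ''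
          (I : Set (X.presheaf.stalk x)))) → y ∈ I) →
      topologicalKrullDim X ≤ 2 →
      ∀ s : X, s ∉ Scheme.regularLocus X → ∃ (V : X.Opens), s ∈ V ∧
        (∀ t : X, t ∉ Scheme.regularLocus X → t ∈ V → t = s) ∧
        ∃ (Y : Scheme.{0}) (ρ : Y ⟶ V), IsProper ρ ∧ Scheme.IsRegular Y ∧
          IsIso (ρ ∣_ (V.ι ⁻¹ᵁ ⟨Scheme.regularLocus X,
            isOpen_regularLocus_of_locallyOfFiniteType_field f⟩)) ∧
          Dense ((ρ ⁻¹ᵁ (V.ι ⁻¹ᵁ ⟨Scheme.regularLocus X,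
            isOpen_regularLocus_of_locallyOfFiniteType_field f⟩) : Y.Opens) : Set Y))
    (p : ℕ) (hp : p.Prime) (k : Type) [Field k] [CharP k p] (X : Scheme.{0})
    (f : X ⟶ Spec (.of k)) [IsSeparated f] [LocallyOfFiniteType f] [QuasiCompact f] [IsIntegral X]
    (hFR : ∀ x : X, IsDomain (X.presheaf.stalk x) ∧ ∀ d : ℕ, ringKrullDim (X.presheaf.stalk x) = d →
      ∀ s : Fin d → X.presheaf.stalk x, (Ideal.span (Set.range s)).radical.IsMaximal →
      ∀ y c : X.presheaf.stalk x, c ≠ 0 →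
      (∀ e : ℕ, c * y ^ p ^ e ∈ Ideal.span ((fun z : X.presheaf.stalk x => z ^ p ^ e) ''
        (Ideal.span (Set.range s) : Set (X.presheaf.stalk x)))) → y ∈ Ideal.span (Set.range s))
    (hdim : topologicalKrullDim X ≤ 2) :
    Scheme.HasResolution X := by
  classical
  -- local weakly-F-regular models at every singular point, glued (as in the previous theorem)
  have hloc : ∀ s : X, s ∉ Scheme.regularLocus X → ∃ (V : X.Opens), s ∈ V ∧
      (∀ t : X, t ∉ Scheme.regularLocus X → t ∈ V → t = s) ∧
      ∃ (Y : Scheme.{0}) (ρ : Y ⟶ V), IsProper ρ ∧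
        (∀ y : Y, IsDomain (Y.presheaf.stalk y) ∧ ∀ I : Ideal (Y.presheaf.stalk y),
          ∀ a c : Y.presheaf.stalk y, c ≠ 0 →
          (∀ e : ℕ, c * a ^ p ^ e ∈ Ideal.span ((fun z : Y.presheaf.stalk y => z ^ p ^ e) ''
            (I : Set (Y.presheaf.stalk y)))) → a ∈ I) ∧
        IsIso (ρ ∣_ (V.ι ⁻¹ᵁ ⟨Scheme.regularLocus X,
          isOpen_regularLocus_of_locallyOfFiniteType_field f⟩)) ∧
        Dense ((ρ ⁻¹ᵁ (V.ι ⁻¹ᵁ ⟨Scheme.regularLocus X,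
          isOpen_regularLocus_of_locallyOfFiniteType_field f⟩) : Y.Opens) : Set Y) := by
    intro s hs
    by_cases hsoc : ∀ d : ℕ, ringKrullDim (X.presheaf.stalk s) = d →
        ∀ t : Fin d → X.presheaf.stalk s, (Ideal.span (Set.range t)).radical.IsMaximal →
        ∃ u : X.presheaf.stalk s, (Ideal.span (Set.range t)).colon
          (IsLocalRing.maximalIdeal (X.presheaf.stalk s) : Set (X.presheaf.stalk s)) =
          Ideal.span (Set.range t) ⊔ Ideal.span {u}
    · exact identity_local_model_of_socle_cyclic p hp k X f hFR hdim s hs hsoc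
    · exact hgerm₁ p hp k X f hFR hdim s hs hsoc
  obtain ⟨X', π, hπ, hbir, hW⟩ :=
    weaklyFRegularModification_surface_of_local p hp k X f hFR hdim hloc
  haveI := hπ
  -- the glued model is again an integral F-rational surface
  obtain ⟨U, hUd, hd, hiso⟩ := hbir
  have hUne : (U : Set X).Nonempty := hUd.nonempty
  haveI : IsIntegral X' := isIntegral_of_model X X' π (fun x => (hW x).1) U hUne hiso hd
  have hdim' : topologicalKrullDim X' ≤ 2 := by
    rw [topologicalKrullDim_eq_of_model k X X' f π U hUne hiso]
    exact hdim
  have hFR' : ∀ x : X', IsDomain (X'.presheaf.stalk x) ∧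
      ∀ d : ℕ, ringKrullDim (X'.presheaf.stalk x) = d →
      ∀ s : Fin d → X'.presheaf.stalk x, (Ideal.span (Set.range s)).radical.IsMaximal →
      ∀ y c : X'.presheaf.stalk x, c ≠ 0 →
      (∀ e : ℕ, c * y ^ p ^ e ∈ Ideal.span ((fun z : X'.presheaf.stalk x => z ^ p ^ e) ''
        (Ideal.span (Set.range s) : Set (X'.presheaf.stalk x)))) → y ∈ Ideal.span (Set.range s) :=
    fun x => ⟨(hW x).1, fun d _ s _ y c hc hy => (hW x).2 (Ideal.span (Set.range s)) y c hc hy⟩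
  -- the crux in dimension 2 is local: resolve `X'` from the local resolutions `hgerm₂`, descend
  have hX' : Scheme.HasResolution X' :=
    hasResolution_fRational_surface_of_local p hp k X' (π ≫ f) hFR' hdim'
      (hgerm₂ p hp k X' (π ≫ f) hW hdim')
  exact Scheme.HasResolution.of_isBirational π ⟨U, hUd, hd, hiso⟩ hX'

end Summit.ResolutionOfSingularities.ResolutionOfSingularities.Theorems.FRationalResolution

end
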